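import Mathlib
import Literature.MathematicalPhysics.QuantumLattice.WilsonDiracAP
import Literature.MathematicalPhysics.QuantumFieldTheory.ConstructiveQFTWave0Proofs
import HarnessLib

/-!
# Link Gram identity, part 8: the reflection-positive form of the temporal gauge
(crux stmt-QuantumFields-9735, line `Sketch`, lead's stub `linkGram`)

The gauge side of the link peel. With `z U = splice crossEdges (U, 1)` (crossing links set to `1`)
and the tree's link reflection `Θ`:
* `exp_neg_wilsonAction_splice` — the Boltzmann weight in the temporal gauge is a GRAM KERNEL,
  `e^{-β S(zU)} = e^{-βN#plaq} · linkKer β U`, `linkKer β U = g(zU) conj g(z ΘU) · exp Σᵢ aᵢ(zU) conj aᵢ(zΘU)`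
  (the tree's `WilsonRP.rpIntegrand_translate` at `Y = 1`: `g = gObs β 1`, `aᵢ = coeff`);
* `linkForm` — the sesquilinear form `B(Φ, Ψ) = ∫ Ψ(U) conj Φ(ΘU) linkKer(U) dU`;
* `linkForm_self_nonneg` — `0 ≤ B(Φ, Φ)` for bounded measurable `Φ` depending on positive-time
  links (the tree's abstract `LatticeRP.integral_mul_conj_mul_exp_nonneg` with NO crossing set).
All statements are proved.
-/

noncomputable section

open MeasureTheory Matrix Complex Finset
open Literature.MathematicalPhysics.QuantumFieldTheory Literature.MathematicalPhysics.QuantumLattice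
open Literature.Probability.LatticeModels (TorusSite)
open scoped ComplexConjugate BigOperators ComplexOrder

namespace Summit.QuantumFields.QCD.Theorems.UnquenchedChessboardBoundLine

variable {L N : ℕ} [NeZero L] [Fact (1 < L)]

/-! ## The temporal-gauge configuration and its reflection -/

/-- The temporal gauge: crossing links set to `1`. -/
def linkZ (U : GaugeConfig 4 L (Matrix.specialUnitaryGroup (Fin N) ℂ)) :
    GaugeConfig 4 L (Matrix.specialUnitaryGroup (Fin N) ℂ) :=
  LatticeRP.splice WilsonRP.crossEdges (U, 1)

omit [Fact (1 < L)] in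
/-- Unfolding `linkZ`. -/
theorem linkZ_apply (U : GaugeConfig 4 L (Matrix.specialUnitaryGroup (Fin N) ℂ)) (e : Edge 4 L) :
    linkZ U e = if e ∈ WilsonRP.crossEdges then 1 else U e := by
  simp [linkZ, LatticeRP.splice_apply]

omit [Fact (1 < L)] in
/-- The temporal gauge is idempotent. -/
theorem splice_linkZ (U : GaugeConfig 4 L (Matrix.specialUnitaryGroup (Fin N) ℂ)) :
    LatticeRP.splice WilsonRP.crossEdges (linkZ U, 1) = linkZ U := by
  funext e
  rw [LatticeRP.splice_apply, linkZ_apply]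
  split_ifs with h
  · rfl
  · show linkZ U e = U e
    rw [linkZ_apply, if_neg h]

omit [Fact (1 < L)] in
/-- **The reflection commutes with the temporal gauge** (crossing layers are mapped to
themselves, `1⁻¹ = 1`). -/
theorem timeReflect_linkZ (hL : Even L) (U : GaugeConfig 4 L (Matrix.specialUnitaryGroup (Fin N) ℂ)) :
    (linkZ U).timeReflect = linkZ U.timeReflect := by
  funext e
  rw [WilsonRP.timeReflect_apply, linkZ_apply, linkZ_apply, WilsonRP.timeReflect_apply]
  have hiff : WilsonRP.edgeReflect e ∈ (WilsonRP.crossEdges : Finset (Edge 4 L)) ↔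
      e ∈ (WilsonRP.crossEdges : Finset (Edge 4 L)) := by
    rw [WilsonRP.mem_crossEdges, WilsonRP.mem_crossEdges]
    constructor
    · intro h
      have := WilsonRP.isCrossEdge_edgeReflect hL h
      rwa [WilsonRP.edgeReflect_edgeReflect] at this
    · exact WilsonRP.isCrossEdge_edgeReflect hL
  by_cases hc : e ∈ (WilsonRP.crossEdges : Finset (Edge 4 L))
  · rw [if_pos (hiff.2 hc), if_pos hc]
    split_ifs <;> simp
  · rw [if_neg (fun h => hc (hiff.1 h)), if_neg hc]

omit [NeZero L] [Fact (1 < L)] in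
/-- `translate 1 = id`. -/
theorem translate_one (V : GaugeConfig 4 L (Matrix.specialUnitaryGroup (Fin N) ℂ)) :
    WilsonRP.translate 1 V = V := by
  funext e
  simp [WilsonRP.translate]

/-! ## The Boltzmann weight in the temporal gauge is a Gram kernel -/

/-- **The Gram kernel of the gauge weight** in the temporal gauge. -/
def linkKer (β : ℝ) (U : GaugeConfig 4 L (Matrix.specialUnitaryGroup (Fin N) ℂ)) : ℂ :=
  WilsonRP.gObs (fundamentalRep (Fin N)) β (fun _ => (1 : ℂ)) (linkZ U) *
    conj (WilsonRP.gObs (fundamentalRep (Fin N)) β (fun _ => (1 : ℂ)) (linkZ (GaugeConfig.timeReflect U))) *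
    Complex.exp (∑ i : WilsonRP.CoeffIndex 4 L N,
      WilsonRP.coeff (fundamentalRep (Fin N)) (continuous_fundamentalRep (Fin N)) β i (linkZ U) *
        conj (WilsonRP.coeff (fundamentalRep (Fin N)) (continuous_fundamentalRep (Fin N)) β i
          (linkZ (GaugeConfig.timeReflect U))))

/-- **The Boltzmann weight in the temporal gauge factorises over the reflection**:
`e^{-β S(zU)} = e^{-βN#plaq} · linkKer β U` (`β ≥ 0`, `L` even). -/
theorem exp_neg_wilsonAction_splice (hL : Even L) {β : ℝ} (hβ : 0 ≤ β)
    (U : GaugeConfig 4 L (Matrix.specialUnitaryGroup (Fin N) ℂ)) :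
    (Real.exp (-β * wilsonAction (fundamentalRep (Fin N)) (linkZ U)) : ℂ) =
      (Real.exp (-β * (N * Fintype.card (Plaquette 4 L))) : ℂ) * linkKer β U := by
  have hdep : DependsOn (fun _ : GaugeConfig 4 L (Matrix.specialUnitaryGroup (Fin N) ℂ) => (1 : ℂ))
      ((WilsonRP.posEdges : Finset (Edge 4 L)) : Set (Edge 4 L)) := fun _ _ _ => rfl
  have h := WilsonRP.rpIntegrand_translate (fundamentalRep (Fin N)) hL (continuous_fundamentalRep (Fin N))
    hβ hdep (linkZ U) 1
  rw [translate_one] at h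
  unfold WilsonRP.rpIntegrand at h
  simp only [map_one, mul_one] at h
  rw [h]
  unfold WilsonRP.rpIntegrand₂ linkKer
  simp only [splice_linkZ, timeReflect_linkZ hL]

/-! ## The reflection-positive sesquilinear form -/

/-- **The form of the link peel**: `B(Φ, Ψ) = ∫ Ψ(U) · conj Φ(ΘU) · linkKer β U dU`. -/
def linkForm (β : ℝ) (Φ Ψ : GaugeConfig 4 L (Matrix.specialUnitaryGroup (Fin N) ℂ) → ℂ) : ℂ :=
  ∫ U, Ψ U * conj (Φ (GaugeConfig.timeReflect U)) * linkKer β U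
    ∂(Measure.pi fun _ : Edge 4 L => haarProbability (Matrix.specialUnitaryGroup (Fin N) ℂ))

omit [Fact (1 < L)] in
/-- If `U` and `V` agree on the positive-time links then `zU` and `zV` agree on `P ∪ C`. -/
theorem linkZ_agree {U V : GaugeConfig 4 L (Matrix.specialUnitaryGroup (Fin N) ℂ)}
    (h : ∀ e ∈ ((WilsonRP.posEdges : Finset (Edge 4 L)) : Set (Edge 4 L)), U e = V e) :
    ∀ e ∈ ((WilsonRP.posEdges ∪ WilsonRP.crossEdges : Finset (Edge 4 L)) : Set (Edge 4 L)),
      linkZ U e = linkZ V e := by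
  intro e he
  rw [linkZ_apply, linkZ_apply]
  by_cases hc : e ∈ (WilsonRP.crossEdges : Finset (Edge 4 L))
  · rw [if_pos hc, if_pos hc]
  · rw [if_neg hc, if_neg hc]
    rw [Finset.coe_union, Set.mem_union] at he
    exact h e (he.resolve_right hc)

omit [Fact (1 < L)] in
/-- `linkZ` is measurable. -/
theorem measurable_linkZ : Measurable (linkZ (L := L) (N := N)) :=
  (LatticeRP.measurable_splice _).comp (measurable_id.prodMk measurable_const)

/-- **Reflection positivity of the form**: `0 ≤ B(Φ, Φ)` for admissible `Φ`. -/
theorem linkForm_self_nonneg (hL : Even L) {β : ℝ} (hβ : 0 ≤ β)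
    {Φ : GaugeConfig 4 L (Matrix.specialUnitaryGroup (Fin N) ℂ) → ℂ} (hΦm : Measurable Φ) {K : ℝ}
    (hK : ∀ U, ‖Φ U‖ ≤ K)
    (hΦdep : DependsOn Φ ((WilsonRP.posEdges : Finset (Edge 4 L)) : Set (Edge 4 L))) :
    0 ≤ linkForm β Φ Φ := by
  set ρF := fundamentalRep (Fin N) with hρF
  have hρ : Continuous ρF := continuous_fundamentalRep (Fin N)
  set μ₀ : Measure (Matrix.specialUnitaryGroup (Fin N) ℂ) := haarProbability _ with hμ₀
  -- the abstract mechanism with no crossing set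
  have key := LatticeRP.integral_mul_conj_mul_exp_nonneg μ₀ WilsonRP.posEdges (∅ : Finset (Edge 4 L))
    GaugeConfig.timeReflect WilsonRP.measurePreserving_timeReflect
    (fun e he => WilsonRP.dependsOn_timeReflect_apply hL e (by
      rw [Finset.union_empty] at he
      exact Finset.mem_union_left _ he))
    (g := fun U => Φ U * WilsonRP.gObs ρF β (fun _ => (1 : ℂ)) (linkZ U))
    (a := fun i U => WilsonRP.coeff ρF hρ β i (linkZ U))
    (hΦm.mul ((WilsonRP.measurable_gObs ρF hρ β measurable_const).comp measurable_linkZ))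
    (fun i => (WilsonRP.measurable_coeff ρF hρ β i).comp measurable_linkZ)
    (Kg := K * (|(1 : ℝ)| * Real.exp (β * (N * Fintype.card (Plaquette 4 L)))))
    (Ka := Real.sqrt (β / 2))
    (fun U => by
      rw [norm_mul]
      exact mul_le_mul (hK U) (WilsonRP.norm_gObs_le ρF hρ hβ (fun _ => by simp) _) (norm_nonneg _)
        ((norm_nonneg _).trans (hK U)))
    (fun i U => WilsonRP.norm_coeff_le ρF hρ β i _)
    (by
      intro U V hUV
      rw [Finset.union_empty] at hUV
      simp only [hΦdep hUV, WilsonRP.dependsOn_gObs ρF β (F := fun _ => (1 : ℂ)) (fun _ _ _ => rfl)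
        (linkZ_agree hUV)])
    (fun i => by
      intro U V hUV
      rw [Finset.union_empty] at hUV
      exact WilsonRP.dependsOn_coeff ρF hL hρ β i (linkZ_agree hUV))
  -- the doubled integral is the single integral (the integrand ignores the second variable)
  have hsplice : ∀ p : GaugeConfig 4 L (Matrix.specialUnitaryGroup (Fin N) ℂ) ×
      GaugeConfig 4 L (Matrix.specialUnitaryGroup (Fin N) ℂ),
      LatticeRP.splice (∅ : Finset (Edge 4 L)) p = p.1 := fun p => by
    funext e; simp [LatticeRP.splice_apply]
  simp_rw [hsplice] at key
  rw [integral_fun_fst (μ := LatticeRP.piMeasure μ₀) (ν := LatticeRP.piMeasure μ₀)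
    (fun U : GaugeConfig 4 L (Matrix.specialUnitaryGroup (Fin N) ℂ) =>
      Φ U * WilsonRP.gObs ρF β (fun _ => (1 : ℂ)) (linkZ U) *
        (starRingEnd ℂ) (Φ (GaugeConfig.timeReflect U) *
          WilsonRP.gObs ρF β (fun _ => (1 : ℂ)) (linkZ (GaugeConfig.timeReflect U))) *
        Complex.exp (∑ i, WilsonRP.coeff ρF hρ β i (linkZ U) *
          (starRingEnd ℂ) (WilsonRP.coeff ρF hρ β i (linkZ (GaugeConfig.timeReflect U)))))] at key
  simp only [probReal_univ, one_smul] at key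
  unfold linkForm
  convert key using 2
  funext U
  unfold linkKer
  simp only [map_mul]
  ring

end Summit.QuantumFields.QCD.Theorems.UnquenchedChessboardBoundLine

end
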